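import Literature.Geometry.DiscreteGeometry.ShellCensusSearchLeaf
import HarnessLib

/-!
# Soundness of the census growth search, part D: Phase 2

Topic `Literature/Geometry/DiscreteGeometry`.  Semantics `RealizesB` of a Phase-2 state (a complete
labelled fan surface with recorded bond flags that are correct for the frame), soundness of the
flag initialisation, of one assignment step `assignWith`, of the certified dead-star predicates,
of the recogniser `isoTo`, and of the Phase-2 driver `assign`.
-/

namespace Literature.Geometry.DiscreteGeometry

namespace ShellCensusSearch

open Finset

/-! ### Flags -/

/-- Flags are stored symmetrically. [folklore] -/
theorem ggb_comm (s : St) (a b : ℕ) : s.ggb a b = s.ggb b a := by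
  unfold St.ggb; rw [sIdx_comm]

/-- Reading a flag after writing one. [folklore] -/
theorem ggb_sgb (s : St) {a b : ℕ} (ha : a < 12) (hb : b < 12) (hs : s.gb.size = 144) (f c d : ℕ) :
    (s.sgb a b f).ggb c d = if sIdx c d = sIdx a b then f else s.ggb c d := by
  unfold St.ggb St.sgb
  exact getD_setIfInBounds _ _ _ _ (by rw [hs]; exact sIdx_lt ha hb)

/-- Writing a flag keeps the size. [folklore] -/
theorem size_sgb (s : St) (a b f : ℕ) : (s.sgb a b f).gb.size = s.gb.size := by
  simp [St.sgb, Array.size_setIfInBounds]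

/-- What `distinctLt` certifies. [folklore] -/
theorem distinctLt_spec {L : List ℕ} (h : distinctLt L = true) : (∀ x ∈ L, x < 12) ∧ L.Nodup := by
  unfold distinctLt at h
  rw [Bool.and_eq_true, List.all_eq_true, decide_eq_true_eq] at h
  exact ⟨fun x hx => by simpa using h.1 x hx, h.2⟩

/-- What `starIs` certifies: the placed star of `v` is the listed set of codes. [folklore] -/
theorem starIs_spec {s : St} {v : ℕ} {T : List ℕ} (h : s.starIs v T = true) (t : ℕ) :
    t ∈ s.trisAt v ↔ t ∈ T := by
  unfold St.starIs at h
  rw [Bool.and_eq_true, List.all_eq_true, List.all_eq_true] at h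
  constructor
  · intro ht; simpa using h.1 t ht
  · intro ht; simpa using h.2 t ht

/-- Reading a constant array inside its range. [folklore] -/
theorem getD_replicate_of_lt {n j : ℕ} (d e : ℕ) (hj : j < n) : (Array.replicate n d : Array ℕ).getD j e = d := by
  simp only [Array.getD_eq_getD_getElem?, Array.getElem?_replicate, hj, ↓reduceIte, Option.getD_some]

/-! ### Phase-2 states -/

namespace RealizesB

variable {M : CF} {φ : ℕ → Fin 12} {s : St}

/-- Labels of placed codes are `< 12`. [folklore] -/
theorem lt12 (h : RealizesB M φ s) {t v : ℕ} (ht : t ∈ s.tris.toList) (hv : v ∈ lset t) : v < 12 :=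
  lt_of_mem_lset (h.valid t ht) hv

/-- Membership in the image triangle. [folklore] -/
theorem mem_tset_iff (h : RealizesB M φ s) {t : ℕ} (ht : t ∈ s.tris.toList) {v : ℕ} (hv : v < 12) :
    φ v ∈ tset φ t ↔ v ∈ lset t := by
  unfold tset
  rw [mem_image]
  constructor
  · rintro ⟨w, hw, he⟩
    rwa [← h.inj w v (h.lt12 ht hw) hv he]
  · intro hv'; exact ⟨v, hv', rfl⟩

/-- Placed codes with the same image are equal. [folklore] -/
theorem eq_of_tset_eq (h : RealizesB M φ s) {t t' : ℕ} (ht : t ∈ s.tris.toList) (ht' : t' ∈ s.tris.toList)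
    (he : tset φ t = tset φ t') : t = t' := by
  apply triValid_ext (h.valid t ht) (h.valid t' ht')
  ext v
  constructor
  · intro hv
    have := (h.mem_tset_iff ht (h.lt12 ht hv)).2 hv
    rw [he] at this
    exact (h.mem_tset_iff ht' (h.lt12 ht hv)).1 this
  · intro hv
    have := (h.mem_tset_iff ht' (h.lt12 ht' hv)).2 hv
    rw [← he] at this
    exact (h.mem_tset_iff ht (h.lt12 ht' hv)).1 this

/-- A triangle of `M` with image vertex set `{φ a, φ b, φ c}` of distinct labels is the placed code
`sortTri a b c`. [folklore] -/
theorem placed_of_mem_tri (h : RealizesB M φ s) {a b c : ℕ} (ha : a < 12) (hb : b < 12) (hc : c < 12)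
    (hab : a ≠ b) (hbc : b ≠ c) (hac : a ≠ c) (hT : ({φ a, φ b, φ c} : Finset (Fin 12)) ∈ M.tri) :
    sortTri a b c ∈ s.tris.toList := by
  obtain ⟨t, ht, he⟩ := h.complete _ hT
  obtain ⟨hv, hl⟩ := sortTri_spec ha hb hc (by norm_num) hab hbc hac
  have hts : tset φ (sortTri a b c) = {φ a, φ b, φ c} := by rw [tset, hl]; simp [image_insert]
  -- lset t = {a, b, c}
  have hlt : lset t = {a, b, c} := by
    ext v
    constructor
    · intro hv'
      have hv12 := h.lt12 ht hv'
      have : φ v ∈ ({φ a, φ b, φ c} : Finset (Fin 12)) := he ▸ (h.mem_tset_iff ht hv12).2 hv'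
      simp only [mem_insert, mem_singleton] at this ⊢
      rcases this with e | e | e
      · exact Or.inl (h.inj v a hv12 ha e)
      · exact Or.inr (Or.inl (h.inj v b hv12 hb e))
      · exact Or.inr (Or.inr (h.inj v c hv12 hc e))
    · intro hv'
      simp only [mem_insert, mem_singleton] at hv'
      rcases hv' with rfl | rfl | rfl
      · exact (h.mem_tset_iff ht ha).1 (he ▸ (by simp))
      · exact (h.mem_tset_iff ht hb).1 (he ▸ (by simp))
      · exact (h.mem_tset_iff ht hc).1 (he ▸ (by simp))
  have := triValid_ext (h.valid t ht) hv (by rw [hlt, hl])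
  rw [← this]; exact ht

/-- The star of `φ v` consists of the images of the placed triangles at `v`. [folklore] -/
theorem mem_star_iff (h : RealizesB M φ s) {v : ℕ} (hv : v < 12) {T : Finset (Fin 12)} :
    T ∈ M.star (φ v) ↔ ∃ t ∈ s.trisAt v, tset φ t = T := by
  rw [← trisAt_eq, CF.mem_star]
  constructor
  · rintro ⟨hT, hvT⟩
    obtain ⟨t, ht, rfl⟩ := h.complete T hT
    exact ⟨t, List.mem_filter.2 ⟨ht, tmem_iff.2 ((h.mem_tset_iff ht hv).1 hvT)⟩, rfl⟩
  · rintro ⟨t, ht, rfl⟩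
    rw [List.mem_filter] at ht
    exact ⟨h.mem t ht.1, (h.mem_tset_iff ht.1 hv).2 (tmem_iff.1 ht.2)⟩

/-- A bond from `φ v` ends at the image of a link label of `v`. [folklore] -/
theorem exists_link_of_bond (h : RealizesB M φ s) {v : ℕ} (hv : v < 12) {w : Fin 12} (hb : M.bond (φ v) w = true) :
    ∃ u ∈ s.link v, φ u = w := by
  have hw := CF.mem_linkF_of_bond hb
  simp only [CF.linkF, mem_filter, mem_univ, true_and] at hw
  obtain ⟨hwv, S, hS, hwS⟩ := hw
  obtain ⟨t, ht, rfl⟩ := (h.mem_star_iff hv).1 hS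
  rw [← trisAt_eq, List.mem_filter] at ht
  obtain ⟨u, hu, rfl⟩ := Realizes.exists_label_of_mem_tset hwS
  have hu12 := h.lt12 ht.1 hu
  refine ⟨u, (mem_link s v u).2 ⟨by rw [h.n_eq]; exact hu12, fun e => hwv (by rw [e]), ?_⟩, rfl⟩
  exact gsc_ne_zero_of_mem ht.1 ht.2 (tmem_iff.2 hu)

/-- Distinct labels with recorded bonds to `u` are at most four. [folklore] -/
theorem length_le_four (h : RealizesB M φ s) {u : ℕ} (hu : u < 12) {L : List ℕ} (hnd : L.Nodup)
    (hL : ∀ x ∈ L, x < 12 ∧ x ≠ u ∧ s.ggb u x = 2) : L.length ≤ 4 := by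
  classical
  have hinj : Set.InjOn φ (L.toFinset : Set ℕ) := by
    intro a ha b hb he
    exact h.inj a b (hL a (by simpa using ha)).1 (hL b (by simpa using hb)).1 he
  have hsub : L.toFinset.image φ ⊆ M.partners (φ u) := by
    intro w hw
    rw [mem_image] at hw
    obtain ⟨x, hx, rfl⟩ := hw
    obtain ⟨hx12, hxu, hf⟩ := hL x (by simpa using hx)
    exact CF.mem_partners.2 (h.flag2 u x hu hx12 (Ne.symm hxu) hf)
  have := card_le_card hsub
  rwa [card_image_of_injOn hinj, List.toFinset_card_of_nodup hnd, CF.card_partners] at this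

/-- The degree test passes. [folklore] -/
theorem bdeg_le (h : RealizesB M φ s) {u : ℕ} (hu : u < 12) : s.bdeg u ≤ 4 := by
  unfold St.bdeg
  apply h.length_le_four hu ((List.nodup_range).filter _)
  intro x hx
  rw [List.mem_filter] at hx
  simp only [List.mem_range, Bool.and_eq_true, bne_iff_ne, ne_eq, beq_iff_eq] at hx
  exact ⟨by rw [← h.n_eq]; exact hx.1, hx.2.1, hx.2.2⟩

end RealizesB

/-! ### From a closed-up Phase-1 leaf to Phase 2 -/

set_option maxRecDepth 4000 in
/-- `initFlags` unfolds to the fold of `initF` (the definitional unfolding is deep: `144` steps).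
[folklore] -/
theorem initFlags_gb_eq (s : St) : s.initFlags.gb = foldRange (initF s) 0 144 s.gb := rfl

/-- `initFlags` closes every label. [folklore] -/
theorem initFlags_cl_eq (s : St) : s.initFlags.cl = Array.replicate 12 1 := rfl

/-- One step of the initialiser. [folklore] -/
theorem initF_apply (s : St) (g : Array ℕ) (i : ℕ) :
    initF s g i = if i / 12 < i % 12 ∧ s.gsc (i / 12) (i % 12) = 0 then g.setIfInBounds (sIdx (i / 12) (i % 12)) 1 else g :=
  rfl

/-- The flag array after `k` steps of the initialiser: index `j < k` is `1` iff `j / 12 < j % 12`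
and that side has count zero; other entries are unchanged. [folklore] -/
theorem initFlags_gb (s : St) (hs : s.gb.size = 144) (k : ℕ) (hk : k ≤ 144) :
    (foldRange (initF s) 0 k s.gb).size = 144 ∧
    ∀ j, (foldRange (initF s) 0 k s.gb).getD j 0 =
      if j < k ∧ j / 12 < j % 12 ∧ s.gsc (j / 12) (j % 12) = 0 then 1 else s.gb.getD j 0 := by
  induction k with
  | zero => simpa [foldRange] using hs
  | succ k ih =>
    obtain ⟨ihs, ihv⟩ := ih (by omega)
    rw [← foldRange_eq] at ihs ihv ⊢
    rw [List.range'_concat, List.foldl_append]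
    simp only [List.foldl_cons, List.foldl_nil, zero_add, one_mul]
    set G := List.foldl (initF s) s.gb (List.range' 0 k) with hG
    rw [initF_apply]
    by_cases hc : k / 12 < k % 12 ∧ s.gsc (k / 12) (k % 12) = 0
    · have hk' : sIdx (k / 12) (k % 12) = k := by unfold sIdx; rw [if_pos hc.1]; omega
      rw [if_pos hc, hk']
      refine ⟨by rw [Array.size_setIfInBounds, ihs], fun j => ?_⟩
      rw [getD_setIfInBounds _ _ _ _ (by rw [ihs]; omega), ihv j]
      by_cases hjk : j = k
      · subst hjk; simp [hc]
      · rw [if_neg hjk]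
        have : (j < k + 1) ↔ (j < k) := by omega
        simp only [this]
    · rw [if_neg hc]
      refine ⟨ihs, fun j => ?_⟩
      rw [ihv j]
      by_cases hjk : j = k
      · subst hjk
        rw [if_neg (fun h => lt_irrefl _ h.1), if_neg]
        rintro ⟨-, h2, h3⟩; exact hc ⟨h2, h3⟩
      · have : (j < k + 1) ↔ (j < k) := by omega
        simp only [this]

/-- The flags of `initFlags` at a pair of distinct labels. [folklore] -/
theorem ggb_initFlags (s : St) (hs : s.gb.size = 144) {a b : ℕ} (ha : a < 12) (hb : b < 12) (hab : a ≠ b) :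
    s.initFlags.ggb a b = if s.gsc a b = 0 then 1 else s.ggb a b := by
  obtain ⟨-, hv⟩ := initFlags_gb s hs 144 le_rfl
  have hj : sIdx a b < 144 := sIdx_lt ha hb
  change s.initFlags.gb.getD (sIdx a b) 0 = if s.gsc a b = 0 then 1 else s.gb.getD (sIdx a b) 0
  rw [initFlags_gb_eq, hv (sIdx a b)]
  rcases Nat.lt_or_gt_of_ne hab with hlt | hlt
  · have e1 : sIdx a b / 12 = a := by unfold sIdx; rw [if_pos hlt]; omega
    have e2 : sIdx a b % 12 = b := by unfold sIdx; rw [if_pos hlt]; omega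
    simp only [hj, e1, e2, hlt, true_and]
  · have e1 : sIdx a b / 12 = b := by unfold sIdx; rw [if_neg (Nat.not_lt.2 hlt.le)]; omega
    have e2 : sIdx a b % 12 = a := by unfold sIdx; rw [if_neg (Nat.not_lt.2 hlt.le)]; omega
    simp only [hj, e1, e2, hlt, true_and, gsc_comm s b a]

/-- Raw flag values of `initFlags` are old values or `1`. [folklore] -/
theorem ggb_initFlags_raw (s : St) (hs : s.gb.size = 144) (a b : ℕ) :
    s.initFlags.ggb a b = 1 ∨ s.initFlags.ggb a b = s.ggb a b := by
  obtain ⟨-, hv⟩ := initFlags_gb s hs 144 le_rfl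
  change s.initFlags.gb.getD (sIdx a b) 0 = 1 ∨ s.initFlags.gb.getD (sIdx a b) 0 = s.gb.getD (sIdx a b) 0
  rw [initFlags_gb_eq, hv (sIdx a b)]
  split_ifs
  · exact Or.inl rfl
  · exact Or.inr rfl

/-- **Entering Phase 2 is sound.** [folklore] -/
theorem initFlags_sound {M : CF} {φ : ℕ → Fin 12} {s : St} (h : Realizes M φ s) (hnone : s.chooseOpen = none) :
    RealizesB M φ s.initFlags := by
  obtain ⟨hn, -, hall⟩ := h.complete_of_no_open hnone
  have htris : s.initFlags.tris = s.tris := rfl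
  have hflag : ∀ a b, a < 12 → b < 12 → a ≠ b → s.initFlags.ggb a b = if s.gsc a b = 0 then 1 else s.ggb a b :=
    fun a b ha hb hab => ggb_initFlags s h.gb_size ha hb hab
  refine
    { n_eq := rfl
      inj := fun p q hp hq => h.inj p q (by rw [hn]; exact hp) (by rw [hn]; exact hq)
      valid := fun t ht => hn ▸ h.valid t ht
      mem := h.mem
      nodup := h.nodup
      complete := hall
      cl_all := fun v hv => by
        change (s.initFlags.cl.getD v 0 != 0) = true
        rw [initFlags_cl_eq, getD_replicate_of_lt 1 0 hv]; rfl
      gb_size := by rw [initFlags_gb_eq]; exact (initFlags_gb s h.gb_size 144 le_rfl).1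
      flag2 := ?_
      flag1 := ?_
      flag_le := ?_ }
  · intro a b ha hb hab hf
    rw [hflag a b ha hb hab] at hf
    by_cases h0 : s.gsc a b = 0
    · rw [if_pos h0] at hf; norm_num at hf
    rw [if_neg h0, h.gb_sem0] at hf
    by_cases h01 : sIdx a b = sIdx 0 1
    · -- {a, b} = {0, 1}
      have : (a = 0 ∧ b = 1) ∨ (a = 1 ∧ b = 0) := by
        by_contra hc
        exact sIdx_ne ha hb (by norm_num) (by norm_num) hc h01
      rcases this with ⟨rfl, rfl⟩ | ⟨rfl, rfl⟩
      · exact h.bond01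
      · rw [M.bond_symm]; exact h.bond01
    · rw [if_neg h01] at hf; norm_num at hf
  · intro a b ha hb hab hf
    rw [hflag a b ha hb hab] at hf
    by_cases h0 : s.gsc a b = 0
    · -- no placed triangle through a, b: not a bond
      by_contra hb'
      rw [Bool.not_eq_false] at hb'
      have h2 := M.bond_side _ _ hb'
      have hpos : 0 < (M.tri.filter fun S' => ({φ a, φ b} : Finset (Fin 12)) ⊆ S').card := by rw [h2]; norm_num
      obtain ⟨T, hT⟩ := card_pos.1 hpos
      rw [mem_filter] at hT
      obtain ⟨t, ht, rfl⟩ := hall T hT.1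
      have hta := (h.mem_tset_iff ht (by rw [hn]; exact ha)).1 (hT.2 (by simp))
      have htb := (h.mem_tset_iff ht (by rw [hn]; exact hb)).1 (hT.2 (by simp))
      exact gsc_ne_zero_of_mem ht (tmem_iff.2 hta) (tmem_iff.2 htb) h0
    · rw [if_neg h0, h.gb_sem0] at hf
      split_ifs at hf; norm_num at hf
  · intro a b
    by_cases hab : a < 12 ∧ b < 12 ∧ a ≠ b
    · rw [hflag a b hab.1 hab.2.1 hab.2.2]
      split_ifs
      · norm_num
      · rw [h.gb_sem0]; split_ifs <;> norm_num
    · -- out of range or diagonal: the raw value is still an old flag or a `1`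
      rcases ggb_initFlags_raw s h.gb_size a b with e | e
      · rw [e]; norm_num
      · rw [e, h.gb_sem0]; split_ifs <;> norm_num

/-! ### One assignment step -/

namespace RealizesB

variable {M : CF} {φ : ℕ → Fin 12} {s : St}

/-- **Writing a correct flag keeps the state realized.** [folklore] -/
theorem sgb (h : RealizesB M φ s) {a b f : ℕ} (ha : a < 12) (hb : b < 12) (hab : a ≠ b) (hf : f = 1 ∨ f = 2)
    (hsem2 : f = 2 → M.bond (φ a) (φ b) = true) (hsem1 : f = 1 → M.bond (φ a) (φ b) = false) :
    RealizesB M φ (s.sgb a b f) := by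
  have hread : ∀ c d, (s.sgb a b f).ggb c d = if sIdx c d = sIdx a b then f else s.ggb c d :=
    fun c d => ggb_sgb s ha hb h.gb_size f c d
  have key : ∀ c d, c < 12 → d < 12 → sIdx c d = sIdx a b → (c = a ∧ d = b) ∨ (c = b ∧ d = a) := by
    intro c d hc hd he
    by_contra hne
    exact sIdx_ne hc hd ha hb hne he
  exact
    { n_eq := h.n_eq
      inj := h.inj
      valid := h.valid
      mem := h.mem
      nodup := h.nodup
      complete := h.complete
      cl_all := h.cl_all
      gb_size := by rw [size_sgb, h.gb_size]
      flag2 := by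
        intro c d hc hd hcd hfl
        rw [hread] at hfl
        split_ifs at hfl with he
        · rcases key c d hc hd he with ⟨rfl, rfl⟩ | ⟨rfl, rfl⟩
          · exact hsem2 hfl
          · rw [M.bond_symm]; exact hsem2 hfl
        · exact h.flag2 c d hc hd hcd hfl
      flag1 := by
        intro c d hc hd hcd hfl
        rw [hread] at hfl
        split_ifs at hfl with he
        · rcases key c d hc hd he with ⟨rfl, rfl⟩ | ⟨rfl, rfl⟩
          · exact hsem1 hfl
          · rw [M.bond_symm]; exact hsem1 hfl
        · exact h.flag1 c d hc hd hcd hfl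
      flag_le := by
        intro c d
        rw [hread]
        split_ifs
        · rcases hf with rfl | rfl <;> norm_num
        · exact h.flag_le c d }

/-- `sgb` does not touch the triangles. [folklore] -/
theorem tris_sgb (s : St) (a b f : ℕ) : (s.sgb a b f).tris = s.tris := rfl

end RealizesB

/-- `assignWith` in terms of the named steps. [folklore] -/
theorem assignWith_eq (s : St) (v : ℕ) (B : List ℕ) :
    s.assignWith v B =
      match B.foldl (fun os w1 => B.foldl (pairF v w1) os) (some (foldRange (rowF v B) 0 12 s)) with
      | none => none
      | some s' => if (List.range 12).all (fun u => decide (s'.bdeg u ≤ 4)) then some s' else none := rfl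

section AssignWith

variable {M : CF} {φ : ℕ → Fin 12}

/-- The row fold is sound. [folklore] -/
theorem rowFold_sound {s : St} (h : RealizesB M φ s) {v : ℕ} (hv : v < 12) {B : List ℕ}
    (hB : ∀ u, u < 12 → u ≠ v → (u ∈ B ↔ M.bond (φ v) (φ u) = true)) (k : ℕ) (hk : k ≤ 12) :
    RealizesB M φ (foldRange (rowF v B) 0 k s) ∧ (foldRange (rowF v B) 0 k s).tris = s.tris := by
  induction k with
  | zero => simpa [foldRange] using h
  | succ k ih =>
    obtain ⟨ihR, iht⟩ := ih (by omega)
    rw [← foldRange_eq] at ihR iht ⊢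
    rw [List.range'_concat, List.foldl_append]
    simp only [List.foldl_cons, List.foldl_nil, zero_add, one_mul]
    set S := List.foldl (rowF v B) s (List.range' 0 k)
    show RealizesB M φ (rowF v B S k) ∧ (rowF v B S k).tris = s.tris
    unfold rowF
    have hk12 : k < 12 := by omega
    by_cases hkv : k = v
    · simp only [hkv, ↓reduceIte]; exact ⟨ihR, iht⟩
    · simp only [hkv, ↓reduceIte]
      by_cases hc : B.contains k = true
      · simp only [hc, ↓reduceIte]
        refine ⟨ihR.sgb hv hk12 (Ne.symm hkv) (Or.inr rfl) (fun _ => ?_) (fun h => by norm_num at h), iht⟩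
        exact (hB k hk12 hkv).1 (by simpa using hc)
      · simp only [hc, Bool.false_eq_true, ↓reduceIte]
        refine ⟨ihR.sgb hv hk12 (Ne.symm hkv) (Or.inl rfl) (fun h => by norm_num at h) (fun _ => ?_), iht⟩
        by_contra hb
        rw [Bool.not_eq_false] at hb
        have : k ∈ B := (hB k hk12 hkv).2 hb
        exact hc (by simpa using this)

/-- The pair folds are sound: no contradiction is recorded and the flags stay correct. [folklore] -/
theorem pairFold_sound {s0 : St} {v : ℕ} (hv : v < 12) {B : List ℕ}
    (hBm : ∀ u ∈ B, u < 12 ∧ u ≠ v ∧ M.bond (φ v) (φ u) = true) (w1 : ℕ) (hw1 : w1 ∈ B) :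
    ∀ (L : List ℕ) (os : Option St), (∀ u ∈ L, u ∈ B) → (∃ s', os = some s' ∧ RealizesB M φ s' ∧ s'.tris = s0.tris) →
      ∃ s', L.foldl (pairF v w1) os = some s' ∧ RealizesB M φ s' ∧ s'.tris = s0.tris := by
  intro L
  induction L with
  | nil => intro os _ hos; simpa using hos
  | cons w2 L ih =>
    intro os hL hos
    obtain ⟨s', rfl, hR, ht⟩ := hos
    rw [List.foldl_cons]
    apply ih _ (fun u hu => hL u (List.mem_cons_of_mem _ hu))
    have hw2 : w2 ∈ B := hL w2 (by simp)
    obtain ⟨h1lt, h1v, h1b⟩ := hBm w1 hw1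
    obtain ⟨h2lt, h2v, h2b⟩ := hBm w2 hw2
    unfold pairF
    simp only []
    by_cases hc : w1 < w2 ∧ (!s'.placed v w1 w2) = true
    · rw [if_pos hc]
      have hne : w1 ≠ w2 := Nat.ne_of_lt hc.1
      -- the pair w1, w2 is not bonded: otherwise the bond triangle {v, w1, w2} would be placed
      have hnb : M.bond (φ w1) (φ w2) = false := by
        by_contra hb
        rw [Bool.not_eq_false] at hb
        have hvw1 : φ v ≠ φ w1 := fun e => h1v.symm (hR.inj v w1 hv h1lt e)
        have hvw2 : φ v ≠ φ w2 := fun e => h2v.symm (hR.inj v w2 hv h2lt e)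
        have hw12 : φ w1 ≠ φ w2 := fun e => hne (hR.inj w1 w2 h1lt h2lt e)
        have hT := M.bond_tri (φ v) (φ w1) (φ w2) hvw1 hw12 hvw2 h1b hb h2b
        have hpl := hR.placed_of_mem_tri hv h1lt h2lt (Ne.symm h1v) hne (Ne.symm h2v) hT
        have : s'.placed v w1 w2 = true := (placed_iff _ _ _ _).2 hpl
        rw [this] at hc
        exact Bool.false_ne_true (by simpa using hc.2)
      have hfl : s'.ggb w1 w2 ≠ 2 := fun h2 => by
        have := hR.flag2 w1 w2 h1lt h2lt hne h2
        rw [hnb] at this; exact Bool.false_ne_true this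
      rw [if_neg hfl]
      exact ⟨_, rfl, hR.sgb h1lt h2lt hne (Or.inl rfl) (fun h => by norm_num at h) (fun _ => hnb), ht⟩
    · rw [if_neg hc]
      exact ⟨s', rfl, hR, ht⟩

/-- **One assignment step is sound**: with the true bond partners of `v` as `B`, `assignWith`
returns a realized state. [folklore] -/
theorem assignWith_sound {s : St} (h : RealizesB M φ s) {v : ℕ} (hv : v < 12) {B : List ℕ}
    (hBm : ∀ u ∈ B, u < 12 ∧ u ≠ v ∧ M.bond (φ v) (φ u) = true)
    (hBc : ∀ u, u < 12 → u ≠ v → M.bond (φ v) (φ u) = true → u ∈ B) :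
    ∃ s', s.assignWith v B = some s' ∧ RealizesB M φ s' ∧ s'.tris = s.tris := by
  rw [assignWith_eq]
  have hB : ∀ u, u < 12 → u ≠ v → (u ∈ B ↔ M.bond (φ v) (φ u) = true) :=
    fun u hu huv => ⟨fun hm => (hBm u hm).2.2, hBc u hu huv⟩
  obtain ⟨hR1, ht1⟩ := rowFold_sound h hv hB 12 le_rfl
  -- the outer fold
  have houter : ∀ (L : List ℕ) (os : Option St), (∀ u ∈ L, u ∈ B) →
      (∃ s', os = some s' ∧ RealizesB M φ s' ∧ s'.tris = s.tris) →
      ∃ s', L.foldl (fun os w1 => B.foldl (pairF v w1) os) os = some s' ∧ RealizesB M φ s' ∧ s'.tris = s.tris := by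
    intro L
    induction L with
    | nil => intro os _ hos; simpa using hos
    | cons w1 L ih =>
      intro os hL hos
      rw [List.foldl_cons]
      apply ih _ (fun u hu => hL u (List.mem_cons_of_mem _ hu))
      exact pairFold_sound (s0 := s) hv hBm w1 (hL w1 (by simp)) B os (fun u hu => hu) hos
  obtain ⟨s2, hs2, hR2, ht2⟩ := houter B _ (fun u hu => hu) ⟨_, rfl, hR1, ht1⟩
  rw [hs2]
  have hdeg : (List.range 12).all (fun u => decide (s2.bdeg u ≤ 4)) = true := by
    rw [List.all_eq_true]
    intro u hu
    simpa using hR2.bdeg_le (u := u) (by simpa using hu)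
  simp only [hdeg, ↓reduceIte]
  exact ⟨s2, rfl, hR2, ht2⟩

end AssignWith

end ShellCensusSearch

end Literature.Geometry.DiscreteGeometry
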